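import Literature.Barriers.RiemannHypothesis.DavenportHeilbronnDegreeTwoLevelOne
import Literature.Barriers.RiemannHypothesis.DavenportHeilbronnDegreeTwoLSeries
import Literature.NumberTheory.LFunctions.DirichletSeriesTwistedZero
import HarnessLib

/-!
# Booker–Thorne at level one: `BookerThorne2014_levelOne_zeros` from twisted zeros (§4, step (1))

Sibling of `DavenportHeilbronnDegreeTwo.lean` (barrier catalogue, D-0021); everything here is
PROVED, there are no definitions and no named facts.

Booker–Thorne prove Theorem 2 (*Zeros of `L`-functions outside the critical strip*, Algebra
Number Theory 8 (2014), §4) in two steps: **(1)** "for every `σ > 1` sufficiently close to `1`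
there are real numbers `t_p` (for each prime `p`) and `t_0` such that `P|_{s = σ + it_0}` vanishes
at `(∏_p L(σ + it_p, π_{1,p}), …, ∏_p L(σ + it_p, π_{n,p}))`" — i.e. a completely multiplicative
unimodular twist `ε` (`ε(p) = p^{-it_p}`) for which the twisted Dirichlet series vanishes at `σ` —
and **(2)** "Simultaneously approximating the `p^{-it_p}` by `p^{-it}` for a common value of `t`,
we use Rouché's theorem to find a zero … `#{…} ≫ T`". Step (2) is the tree's
`Literature.NumberTheory.LFunctions.TwistedZero.hasLinearlyManyZeros_of_twisted_zero`
(`DirichletSeriesTwistedZero.lean`, for an arbitrary absolutely convergent Dirichlet series).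

This file assembles, for Theorem 1 at level one in its quantitative form
(`Literature.Barriers.RiemannHypothesis.BookerThorne2014_levelOne_zeros`), everything except
step (1): the theorem `BookerThorne2014_levelOne_zeros_of_twistedZeros` derives the catalogued
fact from the level-one instance of step (1), stated in the tree's vocabulary as the hypothesis

  `LevelOneTwistedZeros`: for every weight `k`, every finite set `S` of newforms of level one
  (`IsNewform0` on `Γ₀(1) = SL(2, ℤ)`) and coefficients `c` with at least two distinct `g ∈ S`
  having `c_g ≠ 0`, there is `η > 0` such that for every `σ ∈ ((k+1)/2, (k+1)/2 + η]` some
  completely multiplicative unimodular `ε : ℕ →*₀ ℂ` has `∑_n (∑_{g ∈ S} c_g a_g(n)) ε(n) n^{-σ} = 0`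

(written inline as the binder of the theorem — it is NOT introduced as a named fact; it is the
conclusion of Booker–Thorne's Proposition 8 with Lemma 7 for the linear polynomial
`P = ∑ c_g x_g`, shifted by `s ↦ s + (k−1)/2`, whose printed proof needs the Ramanujan bound —
Deligne's theorem, the tree's unproved
`Literature.NumberTheory.EllipticCurves.ModularForms.Deligne1974_heckeT_eigenvalue_norm_le` — and
Lemma 3, the Rankin–Selberg quasi-orthogonality of Hecke eigenvalues, not in the tree).

The assembly: a level-one cusp form which is not a `T_p`-eigenfunction is a combination
`∑_{g ∈ S} c_g g` of the level-one newforms with two non-zero coefficients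
(`exists_newform_combination_of_not_isLevelOneHeckeEigenAt`, step A); its coefficient sequence
`a = ∑ c_g a_g` is not zero (`q`-expansion principle) and `∑ a(n) n^{-s}` converges absolutely for
`Re s > (k+1)/2` (Rankin, tree `LSeriesSummable_cuspCoeff_of_lt_re`); for a strip
`(k+1)/2 < σ₁ < σ₂ ≤ (k+1)/2 + η` take `σ = (σ₁+σ₂)/2`, `r = (σ₂−σ₁)/2`, a twisted zero at
`σ` (hypothesis), `≫ T` zeros of `∑ a(n) n^{-s}` in the strip (step (2)), and transfer them to
`Λ_f` (`levelOne_zeros_of_hasLinearlyManyZeros`, step B).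

## References

* [BookerThorne2014] A. R. Booker, F. Thorne, Algebra Number Theory 8 (2014), 2027–2042, Thm. 1,
  §1 Remark 2, Prop. 8, §4 steps (1)–(2) (arXiv:1306.6362, read).
-/

noncomputable section

open UpperHalfPlane CongruenceSubgroup
open scoped MatrixGroups
open Literature.NumberTheory.EllipticCurves.ModularForms
open Literature.NumberTheory.LFunctions

namespace Literature.Barriers.RiemannHypothesis

/-- The coefficient sequence of a combination of level-one cusp forms whose underlying function
is that of a NON-ZERO form has a non-zero term at some `n ≥ 1` (`q`-expansion principle; the
constant term of a cusp form vanishes). [folklore] -/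
theorem exists_cuspCoeff_sum_ne_zero {k : ℤ} {f : CuspForm 𝒮ℒ k} (hf : f ≠ 0)
    {S : Finset (CuspForm (Gamma0 1) k)} {c : CuspForm (Gamma0 1) k → ℂ}
    (hcoe : (⇑(∑ g ∈ S, c g • g) : ℍ → ℂ) = ⇑f) :
    ∃ n : ℕ, n ≠ 0 ∧ ∑ g ∈ S, c g * cuspCoeff g n ≠ 0 := by
  by_contra hall
  push Not at hall
  have h0 : (∑ g ∈ S, c g • g) = 0 := by
    refine eq_of_forall_cuspCoeff_eq_gamma0 fun n ↦ ?_
    have hz : cuspCoeff (0 : CuspForm (Gamma0 1) k) n = 0 := by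
      simp only [cuspCoeff]
      rw [CuspForm.coe_zero, qExpansion_zero]
      simp
    rw [hz]
    rcases eq_or_ne n 0 with rfl | hn
    · exact cuspCoeff_zero (one_mem_strictPeriods_gamma0 1) _
    · rw [cuspCoeff_sum_smul S (fun g ↦ g) c n]
      exact hall n hn
  apply hf
  apply DFunLike.ext'
  rw [← hcoe, h0, CuspForm.coe_zero, CuspForm.coe_zero]

/-- **`BookerThorne2014_levelOne_zeros` from level-one twisted zeros (Booker–Thorne §4, step (1)
⟹ Theorem 1 with Remark 2, at level one).** If for every finite set `S` of level-one newforms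
and coefficients `c` with two distinct non-zero entries there is `η > 0` such that for every
`σ ∈ ((k+1)/2, (k+1)/2 + η]` some completely multiplicative unimodular twist `ε` kills the
twisted series `∑_n (∑_{g ∈ S} c_g a_g(n)) ε(n) n^{-σ}` (the conclusion of Booker–Thorne's
Proposition 8 with Lemma 7 for `P = ∑ c_g x_g`, shifted by `(k−1)/2`), then every level-one
cusp form which is not a `T_p`-eigenfunction for some prime `p` has `≫ T` distinct zeros of
`Λ_f` in every strip `σ₁ ≤ Re s ≤ σ₂`, `(k+1)/2 < σ₁ < σ₂ ≤ (k+1)/2 + η`, `|Im s| ≤ T`.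
[cite: BookerThorne2014, §4, steps (1)–(2), Thm. 1 and §1, Remark 2] -/
theorem BookerThorne2014_levelOne_zeros_of_twistedZeros
    (hTZ : ∀ (k : ℤ) (S : Finset (CuspForm (Gamma0 1) k)), (↑S : Set _) ⊆ newforms0 1 k →
      ∀ c : CuspForm (Gamma0 1) k → ℂ, (∃ g ∈ S, ∃ g' ∈ S, g ≠ g' ∧ c g ≠ 0 ∧ c g' ≠ 0) →
        ∃ η : ℝ, 0 < η ∧ ∀ σ : ℝ, ((k : ℝ) + 1) / 2 < σ → σ ≤ ((k : ℝ) + 1) / 2 + η →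
          ∃ ε : ℕ →*₀ ℂ, (∀ p, p.Prime → ‖ε p‖ = 1) ∧
            LSeries (fun n ↦ (∑ g ∈ S, c g * cuspCoeff g n) * ε n) σ = 0) :
    BookerThorne2014_levelOne_zeros := by
  intro k f hfp
  obtain ⟨p, hp, hf⟩ := hfp
  obtain ⟨S, c, hS, hcoe, hpair⟩ := exists_newform_combination_of_not_isLevelOneHeckeEigenAt f hp hf
  obtain ⟨η, hη, hzeros⟩ := hTZ k S hS.subset c hpair
  refine ⟨η, hη, fun σ₁ σ₂ h₁ h₁₂ h₂ ↦ ?_⟩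
  -- `f ≠ 0`, so `k ≥ 12 ≥ 0`
  have hf0 : f ≠ 0 := by
    rintro rfl
    apply hf
    refine ⟨0, fun n ↦ ?_⟩
    simp [UpperHalfPlane.qExpansion_zero]
  have hk : 0 ≤ k := le_trans (by norm_num) (twelve_le_weight_of_ne_zero hf0)
  -- the coefficient sequence of the combination
  obtain ⟨a, ha⟩ : ∃ a : ℕ → ℂ, a = fun n ↦ ∑ g ∈ S, c g * cuspCoeff g n := ⟨_, rfl⟩
  have hcoeff : ∀ n, cuspCoeff (∑ g ∈ S, c g • g) n = a n := fun n ↦ by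
    rw [ha, cuspCoeff_sum_smul S (fun g ↦ g) c n]
  have hcoeff' : cuspCoeff (∑ g ∈ S, c g • g) = a := funext hcoeff
  have hsum : ∀ x : ℝ, ((k : ℝ) + 1) / 2 < x → LSeriesSummable a x := by
    intro x hx
    have h := LSeriesSummable_cuspCoeff_of_lt_re (strictWidthInfty_Gamma0 1) (∑ g ∈ S, c g • g)
      (s := (x : ℂ)) (by simpa using hx)
    rwa [hcoeff'] at h
  have hne : ∃ n, n ≠ 0 ∧ a n ≠ 0 := by
    rw [ha]
    exact exists_cuspCoeff_sum_ne_zero hf0 hcoe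
  -- the strip, its centre and half-width
  set σ : ℝ := (σ₁ + σ₂) / 2 with hσ
  set r : ℝ := (σ₂ - σ₁) / 2 with hr
  set σ₀ : ℝ := (((k : ℝ) + 1) / 2 + σ₁) / 2 with hσ₀
  have hr0 : 0 < r := by rw [hr]; linarith
  have hσ₀k : ((k : ℝ) + 1) / 2 < σ₀ := by rw [hσ₀]; linarith
  have hσ₀r : σ₀ < σ - r := by rw [hσ₀, hσ, hr]; linarith
  -- a twisted zero at `σ`
  obtain ⟨ε, hε, hz⟩ := hzeros σ (by rw [hσ]; linarith) (by rw [hσ]; linarith)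
  have hz' : LSeries (fun n ↦ a n * ε n) σ = 0 := by simpa only [ha] using hz
  -- step (2)
  have hmany : HasLinearlyManyZeros (LSeries a) σ₁ σ₂ :=
    TwistedZero.hasLinearlyManyZeros_of_twisted_zero (fun x hx ↦ hsum x (lt_trans hσ₀k hx)) hne hε
      hr0 hσ₀r hz' (by rw [hσ, hr]; linarith) (by rw [hσ, hr]; linarith)
  -- back to the combination of `L(g, ·)` and to `Λ_f`
  have hmany' : HasLinearlyManyZeros (fun s ↦ ∑ g ∈ S, c g * cuspFormLSeries g s) σ₁ σ₂ := by
    obtain ⟨c₀, hc₀, T₀, hT⟩ := hmany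
    refine ⟨c₀, hc₀, T₀, fun T hTT ↦ ?_⟩
    obtain ⟨Z, hZ, hmem⟩ := hT T hTT
    refine ⟨Z, hZ, fun s hs ↦ ?_⟩
    obtain ⟨hs1, hs2, hs3, hs4⟩ := hmem s hs
    refine ⟨hs1, hs2, hs3, ?_⟩
    have hsre : ((k : ℝ) + 1) / 2 < s.re := lt_trans h₁ hs1
    show ∑ g ∈ S, c g * cuspFormLSeries g s = 0
    rw [← cuspFormLSeries_sum_smul S (fun g ↦ g) c hsre]
    show LSeries (cuspCoeff (∑ g ∈ S, c g • g)) s = 0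
    rw [hcoeff']
    exact hs4
  exact levelOne_zeros_of_hasLinearlyManyZeros hk f hcoe h₁ hmany'

end Literature.Barriers.RiemannHypothesis
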